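import Summits.KontsevichZagierPeriods.KontsevichZagierPeriods.Theorems.SymplecticScissorsRealOnePeriodRelationsTorsionCurve

/-!
# Crux `RealOnePeriodRelations` (stmt-KontsevichZagierPeriods-10042), line `nash-retraction-thin-strip`, reshape 10:
# the torsion-punctured curve `C_T` is smooth; tangent lines along `ψ_T`; the inclusion `ι : C_T → E_L`

Second helper file of reshape 10 (torsion / third-kind layer; lead c8), continuing
`…TorsionCurve.lean`: `smoothP` (smoothness over `ℚ̄`), `exists_eq_smul_psiPD` and the analytic criterion
`vanishesOn_curveP_of_psi` for identities of forms on `C_T`, and the inclusion lemmas `iota_psiP`, `iota_mapsTo_P`,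
`pair_pderiv_iota_P`, `eval_invX_psiP`. Verbatim the `curveT` section of
`Literature/NumberTheory/Transcendental/CurvePeriodsEllipticTranslationProofs.lean` with the product `∏ (x − a)`.
[cite: HuberWustholz2022, §13.2, §18.1] [cite: SilvermanAEC2009, III.2.3]
-/

noncomputable section

open scoped BigOperators Topology PeriodPair
open Set Filter MvPolynomial Complex
open Literature.NumberTheory.Transcendental Literature.NumberTheory.Transcendental.CurvePeriods
open Literature.NumberTheory.Transcendental.CurvePeriods.Ell

namespace Summit.KontsevichZagierPeriods.SymplecticScissors.RealOnePeriodRelations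

namespace TorsionLayer

variable (L : PeriodPair)

/-- **`C_T` is a smooth affine curve over `ℚ̄`** (for `g₂, g₃ ∈ ℚ̄` and algebraic `a ∈ T`). [folklore] -/
theorem smoothP : ∀ (L : PeriodPair), IsAlgebraic ℚ L.g₂ → IsAlgebraic ℚ L.g₃ → ∀ {T : Finset ℂ}, (∀ a ∈ T, IsAlgebraic ℚ a) → (curveP L T).IsSmoothAffineCurve := by
  intro L h₂ h₃ T hT
  exact {
  algebraic := fun j => by
    fin_cases j
    · simpa using ((hasAlgCoeffs_X (n := 3) 1).pow 2).sub (hasAlgCoeffs_fPoly3 L h₂ h₃)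
    · simpa using ((hasAlgCoeffs_X (n := 3) 2).mul (hasAlgCoeffs_prodP hT)).sub hasAlgCoeffs_one
  rank_eq := fun q hq => by
    have hq' := hq
    rw [mem_points_curveP_iff] at hq
    obtain ⟨hcub, hw⟩ := hq
    have hx : ∏ a ∈ T, (q 0 - a) ≠ 0 := fun h => by simp [h] at hw
    have hfun : (fun j => (curveP L T).gradient j q) =
        ![![-(3 * q 0 ^ 2 + A L), 2 * q 1, 0], ![q 2 * eval q (pderiv 0 (prodP T)), 0, ∏ a ∈ T, (q 0 - a)]] := by
      funext j
      fin_cases j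
      · simpa using gradient_curveP_zero L T q
      · simpa using gradient_curveP_one L T q
    have hli : LinearIndependent ℂ
        ![![-(3 * q 0 ^ 2 + A L), 2 * q 1, 0], ![q 2 * eval q (pderiv 0 (prodP T)), 0, ∏ a ∈ T, (q 0 - a)]] := by
      rw [LinearIndependent.pair_iff]
      intro s t hst
      have h2 := congrFun hst 2
      have h1 := congrFun hst 1
      have h0 := congrFun hst 0
      simp only [Pi.add_apply, Pi.smul_apply, Matrix.cons_val_zero, Matrix.cons_val_one,
        Matrix.head_cons, smul_eq_mul, mul_zero, zero_add, add_zero, Pi.zero_apply,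
        Matrix.cons_val_two, Matrix.tail_cons] at h0 h1 h2
      have ht : t = 0 := (mul_eq_zero.mp h2).resolve_right hx
      rw [ht, zero_mul, add_zero] at h0
      have hs : s = 0 := by
        by_contra hs
        have hy : q 1 = 0 := by
          rcases mul_eq_zero.mp h1 with h | h
          · exact absurd h hs
          · exact (mul_eq_zero.mp h).resolve_left two_ne_zero
        have hf := fderiv_ne_zero_of_y_eq_zero L hcub hy
        rcases mul_eq_zero.mp h0 with h | h
        · exact hs h
        · exact hf (neg_eq_zero.mp h)
      exact ⟨hs, ht⟩
    rw [hfun, finrank_span_eq_card hli]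
    rfl
  not_isolated := fun q hq => by
    obtain ⟨z₀, hz₀, hne, rfl⟩ := exists_psiP_eq L T hq
    have hev1 := eventually_shift_notMem L hz₀
    have hev2 := eventually_shift_prodFun_ne L T hz₀ hne
    have hev3 : ∀ᶠ t : ℝ in 𝓝[≠] 0, psiP L T (z₀ + (t : ℂ)) ≠ psiP L T z₀ := by
      by_cases hy2 : ℘'[L] z₀ = 0
      · have hq := psiP_mem_points L T hz₀ hne
        rw [mem_points_curveP_iff] at hq
        have hf : 3 * ℘[L] z₀ ^ 2 + A L ≠ 0 :=
          fderiv_ne_zero_of_y_eq_zero L (q := psiP L T z₀) hq.1 (by simp [hy2])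
        have hd : HasDerivAt (fun t : ℝ => ℘'[L] (z₀ + (t : ℂ)) / 2) (3 * ℘[L] z₀ ^ 2 - L.g₂ / 4) 0 := by
          have h := hasDerivAt_psiP_shift L T z₀ (t := 0) (by simpa using hz₀) (by simpa using hne) 1
          simpa using h
        have hne' : 3 * ℘[L] z₀ ^ 2 - L.g₂ / 4 ≠ 0 := by
          have e : 3 * ℘[L] z₀ ^ 2 - L.g₂ / 4 = 3 * ℘[L] z₀ ^ 2 + A L := by rw [A]; ring
          rwa [e]
        filter_upwards [hd.eventually_ne hne'] with t ht h
        have h1 : ℘'[L] (z₀ + (t : ℂ)) / 2 = ℘'[L] z₀ / 2 := congrFun h 1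
        apply ht
        show ℘'[L] (z₀ + (t : ℂ)) / 2 = ℘'[L] (z₀ + ((0 : ℝ) : ℂ)) / 2
        rw [h1, ofReal_zero, add_zero]
      · have hd : HasDerivAt (fun t : ℝ => ℘[L] (z₀ + (t : ℂ))) (℘'[L] z₀) 0 := by
          have h := hasDerivAt_psiP_shift L T z₀ (t := 0) (by simpa using hz₀) (by simpa using hne) 0
          simpa using h
        filter_upwards [hd.eventually_ne hy2] with t ht h
        have h0 : ℘[L] (z₀ + (t : ℂ)) = ℘[L] z₀ := congrFun h 0
        apply ht
        show ℘[L] (z₀ + (t : ℂ)) = ℘[L] (z₀ + ((0 : ℝ) : ℂ))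
        rw [h0, ofReal_zero, add_zero]
    have hcont : Tendsto (fun t : ℝ => psiP L T (z₀ + (t : ℂ))) (𝓝 0) (𝓝 (psiP L T z₀)) := by
      rw [tendsto_pi_nhds]
      intro k
      have h := (hasDerivAt_psiP_shift L T z₀ (t := 0) (by simpa using hz₀) (by simpa using hne)
        k).continuousAt.tendsto
      simpa using h
    refine mem_closure_of_tendsto (b := 𝓝[≠] (0 : ℝ)) (f := fun t : ℝ => psiP L T (z₀ + (t : ℂ)))
      (hcont.mono_left nhdsWithin_le_nhds) ?_
    filter_upwards [mem_nhdsWithin_of_mem_nhds hev1, mem_nhdsWithin_of_mem_nhds hev2, hev3]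
      with t ht1 ht2 ht3
    exact ⟨psiP_mem_points L T ht1 ht2, ht3⟩ }

/-- At `ψ_T(z)` every tangent vector of `C_T` is a multiple of `ψ_T′(z)`. [folklore] -/
theorem exists_eq_smul_psiPD {T : Finset ℂ} (hE : (curveP L T).IsSmoothAffineCurve) {z : ℂ} (hz : z ∉ L.lattice)
    (hne : prodFun L T z ≠ 0) {t : Fin 3 → ℂ} (ht : t ∈ (curveP L T).tangentSpace (psiP L T z)) :
    ∃ c : ℂ, t = c • psiPD L T z := by
  have hpar := tangent_parallel hE (psiP_mem_points L T hz hne) ht (psiPD_mem_tangentSpace L T hne)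
  by_cases hy2 : ℘'[L] z = 0
  · have hq := psiP_mem_points L T hz hne
    rw [mem_points_curveP_iff] at hq
    have hf : 3 * ℘[L] z ^ 2 + A L ≠ 0 :=
      fderiv_ne_zero_of_y_eq_zero L (q := psiP L T z) hq.1 (by simp [hy2])
    have hne1 : psiPD L T z 1 ≠ 0 := by
      rw [psiPD_apply_one]
      have e : 3 * ℘[L] z ^ 2 - L.g₂ / 4 = 3 * ℘[L] z ^ 2 + A L := by rw [A]; ring
      rwa [e]
    refine ⟨t 1 / psiPD L T z 1, funext fun j => ?_⟩
    have h := hpar 1 j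
    simp only [Pi.smul_apply, smul_eq_mul]
    field_simp
    linear_combination h
  · have hne0 : psiPD L T z 0 ≠ 0 := by rwa [psiPD_apply_zero]
    refine ⟨t 0 / psiPD L T z 0, funext fun j => ?_⟩
    have h := hpar 0 j
    simp only [Pi.smul_apply, smul_eq_mul]
    field_simp
    linear_combination h

/-- **A form vanishes on `C_T` as soon as it kills `ψ_T′(z)` at every `ψ_T(z)`.** [folklore] -/
theorem vanishesOn_curveP_of_psi {T : Finset ℂ} (hE : (curveP L T).IsSmoothAffineCurve)
    (ν : Fin 3 → MvPolynomial (Fin 3) ℂ)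
    (h : ∀ z, z ∉ L.lattice → prodFun L T z ≠ 0 → ∑ i, eval (psiP L T z) (ν i) * psiPD L T z i = 0) :
    VanishesOn (curveP L T) ν := by
  intro q hq t ht
  obtain ⟨z, hz, hne, rfl⟩ := exists_psiP_eq L T hq
  obtain ⟨c, rfl⟩ := exists_eq_smul_psiPD L hE hz hne ht
  simp only [Pi.smul_apply, smul_eq_mul]
  have e : ∑ i, eval (psiP L T z) (ν i) * (c * psiPD L T z i) =
      c * ∑ i, eval (psiP L T z) (ν i) * psiPD L T z i := by
    rw [Finset.mul_sum]
    refine Finset.sum_congr rfl fun i _ => ?_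
    ring
  rw [e, h z hz hne, mul_zero]

/-- `ι(ψ_T(z)) = φ(z)`. [folklore] -/
theorem iota_psiP (T : Finset ℂ) (z : ℂ) : (fun j => eval (psiP L T z) (iota j)) = phi L z := by
  rw [iota_eval]; rfl

/-- `ι` maps `C_T` into `E_L`. [folklore] -/
theorem iota_mapsTo_P (T : Finset ℂ) : ∀ q ∈ (curveP L T).points, (fun j => eval q (iota j)) ∈ (curve L).points := by
  intro q hq
  rw [mem_points_curveP_iff] at hq
  rw [iota_eval, Weier.mem_points_iff, Weier.eval_fPoly]
  simpa [sub_eq_zero] using hq.1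

/-- `Dι(ψ_T(z)) ψ_T′(z) = φ′(z)`. [folklore] -/
theorem pair_pderiv_iota_P (T : Finset ℂ) (z : ℂ) (j : Fin 2) :
    ∑ i, eval (psiP L T z) (pderiv i (iota j)) * psiPD L T z i = phiD L z j := by
  fin_cases j <;> simp [iota, Pi.single_apply]

/-- `invX T a` is `1/(x − a)` along `ψ_T` (`a ∈ T`). [folklore] -/
theorem eval_invX_psiP {T : Finset ℂ} {a : ℂ} (ha : a ∈ T) {z : ℂ} (hne : prodFun L T z ≠ 0) :
    eval (psiP L T z) (invX T a) = (℘[L] z - a)⁻¹ := by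
  have hza : ℘[L] z - a ≠ 0 := sub_ne_zero.2 ((prodFun_ne_zero_iff L T z).1 hne a ha)
  rw [invX, map_mul, eval_X, eval_cofP, psiP_apply_two, psiP_apply_zero, prodFun,
    ← Finset.mul_prod_erase T (fun b => ℘[L] z - b) ha]
  have hc : ∏ b ∈ T.erase a, (℘[L] z - b) ≠ 0 :=
    Finset.prod_ne_zero_iff.2 fun b hb => sub_ne_zero.2 ((prodFun_ne_zero_iff L T z).1 hne b (Finset.mem_of_mem_erase hb))
  field_simp

end TorsionLayer

end Summit.KontsevichZagierPeriods.SymplecticScissors.RealOnePeriodRelations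

end
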